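import Summits.ResolutionOfSingularities.ResolutionOfSingularities.Theorems.HilbertSamuelEliminationSigmaMaxModificationsCorridor3WLadderStrataKernels
import HarnessLib

/-!
# [OURS · L1 W4.2] The STRATA-half of the MOVING W-ladder, fourth layer: the REPLAY row (c-rep) REDUCED to REGULARITY OF THE
# TREATED PART AT THE CHAIN POINT at late cycle starts (c-reg) — the replay bookkeeping of CJS Rem. 6.29 (1), PROVED

Crux chain w42 (`SigmaMaxModifications`, stmt-ResolutionOfSingularities-18506; skeleton `w_ladder` v5b on
`SigmaMaxModificationsCorridor3`, stmt-ResolutionOfSingularities-19249), row «stub-4 → `Moving.Wlow3CharStrataM p`», seat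
res-L1-w42-stub-4 (gen 3); companion of p500484 / p503069 / p503885 / p504439 / p505314 / p506465. OURS (cell res-hironaka,
slot W4.2); NOT statements of H. Hironaka's manuscript [Hironaka2017] nor of [CossartJannsenSaito2020]; AI-drafted, weaker than expert
review. Every `theorem` is PROVED; the open content is the one `def … : Prop` row (c-reg). Helper file
`--supports stmt-ResolutionOfSingularities-19249`.

## The argument (no geometry)

Row (c-rep) `StrataReplayBlowupsSettle` asks that, late along the chain, the marked point `x_n` lies in the canonical centre only at
CYCLE-END steps. The other steps are REPLAY steps: their centre is `φ_* D`, `φ : S' ↪ X_n` the replayed strict transform of the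
treated part `S_r = (Y_r^{(j)})_red` at the cycle's start `r ≤ n`, `D` a centre of the oracle's resolution sequence of `S_r` —
which, for an ADMISSIBLE oracle, lies OVER THE NON-REGULAR LOCUS of `S_r` (`OracleAdmissible`: `CentresOver (Reg S_r)ᶜ`). The
replay squares `φ' ≫ π_{φ_* D} = π_D ≫ φ` recorded by the tree's `IsReplayStep` carry this along the cycle
(`StepProjection.centresOver_of_some`: inside a cycle the centres still to be replayed lie over the preimage of `ι_r(Reg S_r)ᶜ`
under «replayed immersion, then the blow-downs to stage `r`»), so a replay centre containing `x_n` forces `x_r ∈ ι_r((Reg S_r)ᶜ)`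
(`StepProjection.support_subset_image_of_some`, `…_of_none`; the blow-downs map `x_n ↦ x_r`, `chainComp_base_pt`). Hence:

(c-rep) ⟸ (c-reg) `StrataCycleStartRegular`: «from some stage on, at every cycle START `r` the reduced treated part
`S_r = (Y_r^{(j)})_red` is REGULAR AT THE CHAIN POINT (every point of `S_r` over `x_r` is a regular point of `S_r`)» —
`strataReplayBlowupsSettle_of_cycleStartRegular`, PROVED for every origin predicate `Q` and grade `G` (the cycle package is
available along every chain, p506465 `exists_cycleInv_chain'`, and gives closed parts). (c-reg) is tri-1's claim «after its first
cycle a label's part through the chain point is ONE regular curve» (TRIAGE v3 R3-F′ (P2) / R3-B2: the dominating near curve `Z ≅ D`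
over a regular curve through a point with `ē ≤ 2` — Thm. 3.6, Thm. 3.14 at `η_D`, finite birational onto regular). With it the
strata-half reads `Wlow3CharStrataM p ⟸ (b-end) ∧ (c-geo) ∧ (c-reg)` (`wlow3CharStrataM_of_births_centreIO_cycleStartRegular`).

References: CJS LNM 2270 Rem. 6.29 (1) pp. 91–92, p. 102 («we obtain the centers from the canonical resolution sequence for
`Y_r^{(j)}`»), Thm. 3.6, Thm. 3.14 [CossartJannsenSaito2020]; Görtz–Wedhorn I Prop. 13.91 (1), 13.96 (2) [GortzWedhorn2020]; tree
`Literature…CanonicalEliminationSequence` (`IsReplayStep`, `OracleAdmissible`, `CentreSeq.CentresOver`), this seat's files above.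
-/

noncomputable section

-- plan-1/idea-2 module setting kept (namespace `…Corridor3.Moving` re-enters `…Corridor3`)
set_option linter.dupNamespace false

open CategoryTheory AlgebraicGeometry TopologicalSpace Topology
open Summit.ResolutionOfSingularities.ResolutionOfSingularities.Theorems.CampaignW42
open Literature.AlgebraicGeometry.Resolution Literature.RingTheory.HilbertSamuel
open Literature.AlgebraicGeometry.CossartJannsenSaito2020
open Summit.ResolutionOfSingularities.ResolutionOfSingularities.Theorems.SigmaMaxModificationsCorridor3

universe u

namespace Summit.ResolutionOfSingularities.ResolutionOfSingularities.Theorems.SigmaMaxModificationsCorridor3.Moving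

variable {R : ∀ S : Scheme.{u}, CentreSeq S → Prop} {N : ℕ} {ν : ℕ → ℕ}

/-! ## §1. The treated part as a reduced closed subscheme; the least label at a cycle start -/

/-- [OURS · L1 W4.2] THE REDUCED TREATED PART `S = (Y_n^{(j)})_red` of a marked stage, for a closed label part: the closed subscheme
`V(vanishingIdeal Y_n^{(j)})` — the scheme whose canonical resolution sequence the cycle replays (CJS Rem. 6.29 (1), tree
`IsCanonicalStep`). [cite: CossartJannsenSaito2020, Rem. 6.29 (1)] -/
abbrev treatedPartIdeal (N : ℕ) (ν : ℕ → ℕ) (s : MarkedStage.{u}) (j : ℕ)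
    (hcl : IsClosed (s.L.part (Scheme.hsStratum s.W N ν) j)) : s.W.IdealSheafData :=
  Scheme.IdealSheafData.vanishingIdeal ⟨s.L.part (Scheme.hsStratum s.W N ν) j, hcl⟩

/-- Between cycles, with a non-empty stratum, the treated label IS the least non-empty label. [cite: CossartJannsenSaito2020, Rem. 6.29 (1)] -/
theorem isLeast_treatedLabel_of_none {s : MarkedStage.{u}} (hP : s.P = none) (hne : (Scheme.hsStratum s.W N ν).Nonempty) :
    IsLeast {i | (s.L.part (Scheme.hsStratum s.W N ν) i).Nonempty} (treatedLabel N ν s) := by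
  rw [treatedLabel_of_none hP]
  obtain ⟨j, hj⟩ := s.L.exists_isLeast_part_nonempty hne
  rwa [hj.csInf_eq]

/-- Preimages along a composite of scheme morphisms (pointwise `(f ≫ g) x = g (f x)`). [folklore] -/
theorem base_preimage_comp {X Y Z : Scheme.{u}} (f : X ⟶ Y) (g : Y ⟶ Z) (T : Set Z) :
    (f ≫ g).base ⁻¹' T = f.base ⁻¹' (g.base ⁻¹' T) := by
  ext z
  simp only [Set.mem_preimage, Scheme.Hom.comp_base, TopCat.comp_app]

/-! ## §2. Replay bookkeeping along one step projection -/

namespace StepProjection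

variable {s s' : MarkedStage.{u}} {f : s'.W ⟶ s.W}

/-- **A cycle START whose next state is inside a cycle: the centres still to be replayed lie over the non-regular locus of the
treated part** (admissible oracle), read through the replayed immersion followed by the blow-down `f`.
[cite: CossartJannsenSaito2020, Rem. 6.29 (1), p. 102] -/
theorem centresOver_of_none (hRa : OracleAdmissible R) (hf : StepProjection R N ν s s' f) (hP : s.P = none) {j : ℕ}
    (hj : IsLeast {i | (s.L.part (Scheme.hsStratum s.W N ν) i).Nonempty} j)
    (hcl : IsClosed (s.L.part (Scheme.hsStratum s.W N ν) j)) {Q' : Pending s'.W} (hQ' : s'.P = some Q') :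
    Q'.rest.CentresOver ((Q'.hom ≫ f).base ⁻¹'
      ((treatedPartIdeal N ν s j hcl).subschemeι.base '' (Scheme.regularLocus (treatedPartIdeal N ν s j hcl).subscheme)ᶜ)) := by
  obtain ⟨C, P', hln, x', hcs, -, -, -, e, rfl⟩ := hf
  subst e
  change P' = some Q' at hQ'
  rw [hP] at hcs
  obtain ⟨j₀, hj₀, hcl₀, t, hRt, hrep⟩ := hcs
  have hjj : j = j₀ := hj.unique hj₀
  subst hjj
  obtain ⟨-, hover, -⟩ := hRa _ _ hRt
  cases t with
  | nil _ =>
    obtain ⟨-, hnone⟩ := hrep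
    rw [hnone] at hQ'
    exact absurd hQ' (by simp)
  | cons D rest =>
    obtain ⟨-, φ', hφ', hsq, hsome⟩ := hrep
    rw [hsome] at hQ'
    cases hQ'
    obtain ⟨-, hrest⟩ := hover
    -- the square `φ' ≫ π_C = π_D ≫ ι` identifies the two preimages
    simp only [eqToHom_refl, Category.id_comp]
    rw [base_preimage_comp, ← base_preimage_comp, hsq, base_preimage_comp]
    show rest.CentresOver ((blowup.π D).base ⁻¹' ((treatedPartIdeal N ν s j hcl).subschemeι.base ⁻¹'
      ((treatedPartIdeal N ν s j hcl).subschemeι.base '' (Scheme.regularLocus (treatedPartIdeal N ν s j hcl).subscheme)ᶜ)))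
    rw [(treatedPartIdeal N ν s j hcl).subschemeι.isClosedEmbedding.injective.preimage_image]
    exact hrest

/-- **Inside a cycle the replay invariant propagates**: if the centres still to be replayed at `s` lie over `T` through
«replayed immersion, then `g`», then after the step they lie over `T` through «replayed immersion, then the blow-down `f`, then `g`»
(the replay square `φ' ≫ π_C = π_D ≫ φ`). [cite: CossartJannsenSaito2020, Rem. 6.29 (1)] [cite: GortzWedhorn2020, Prop. 13.91 (1)] -/
theorem centresOver_of_some (hf : StepProjection R N ν s s' f) {Q : Pending s.W} (hP : s.P = some Q) {B : Scheme.{u}}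
    (g : s.W ⟶ B) (T : Set B) (hco : Q.rest.CentresOver ((Q.hom ≫ g).base ⁻¹' T)) {Q' : Pending s'.W}
    (hQ' : s'.P = some Q') : Q'.rest.CentresOver ((Q'.hom ≫ f ≫ g).base ⁻¹' T) := by
  obtain ⟨C, P', hln, x', hcs, -, -, -, e, rfl⟩ := hf
  subst e
  change P' = some Q' at hQ'
  rw [hP] at hcs
  obtain ⟨-, hrep⟩ := hcs
  haveI := Q.isClosedImmersion
  generalize hr : Q.rest = r at hrep hco
  cases r with
  | nil _ =>
    obtain ⟨-, hnone⟩ := hrep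
    rw [hnone] at hQ'
    exact absurd hQ' (by simp)
  | cons D t =>
    obtain ⟨-, φ', hφ', hsq, hsome⟩ := hrep
    rw [hsome] at hQ'
    cases hQ'
    obtain ⟨-, ht⟩ := hco
    simp only [eqToHom_refl, Category.id_comp]
    rw [← Category.assoc, base_preimage_comp, hsq, base_preimage_comp] at ⊢
    rw [base_preimage_comp] at ht
    exact ht

/-- **The centre of a REPLAY step lies over the replay invariant's set**: if the next state is inside a cycle (the step is not a cycle
end) and the centres still to be replayed at `s` lie over `S₀`, then the centre of THE canonical step from `s` (functional oracle) has
support inside the image of `S₀` under the replayed immersion. [cite: CossartJannsenSaito2020, Rem. 6.29 (1)] -/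
theorem support_subset_image_of_some (hRf : OracleFunctional R) (hf : StepProjection R N ν s s' f) {Q : Pending s.W}
    (hP : s.P = some Q) (hs' : s'.P ≠ none) {S₀ : Set Q.src} (hco : Q.rest.CentresOver S₀) {C : s.W.IdealSheafData}
    {P' : Option (Pending (blowup C))} (hcs : IsCanonicalStep R N ν s.L s.P C P') :
    (C.support : Set s.W) ⊆ Q.hom.base '' S₀ := by
  obtain ⟨C₀, P₀, hln, x', hcs₀, -, -, -, e, rfl⟩ := hf
  subst e
  change P₀ ≠ none at hs'
  obtain rfl : C = C₀ := hcs.centre_unique hRf hcs₀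
  rw [hP] at hcs₀
  obtain ⟨-, hrep⟩ := hcs₀
  haveI := Q.isClosedImmersion
  generalize hr : Q.rest = r at hrep hco
  cases r with
  | nil _ =>
    obtain ⟨-, hnone⟩ := hrep
    exact absurd hnone hs'
  | cons D t =>
    have hsupp : (C.support : Set s.W) = closure (Q.hom.base '' (D.support : Set Q.src)) := hrep.support_eq_closure
    obtain ⟨hD, -⟩ := hco
    rw [hsupp, (Q.hom.isClosedEmbedding.isClosedMap _ D.support.isClosed).closure_eq]
    exact Set.image_mono hD

/-- **The centre of a cycle START that is not at once a cycle end lies over the non-regular locus of the treated part** (admissible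
functional oracle). [cite: CossartJannsenSaito2020, Rem. 6.29 (1), p. 102] -/
theorem support_subset_image_of_none (hRf : OracleFunctional R) (hRa : OracleAdmissible R) (hf : StepProjection R N ν s s' f)
    (hP : s.P = none) {j : ℕ} (hj : IsLeast {i | (s.L.part (Scheme.hsStratum s.W N ν) i).Nonempty} j)
    (hcl : IsClosed (s.L.part (Scheme.hsStratum s.W N ν) j)) (hs' : s'.P ≠ none) {C : s.W.IdealSheafData}
    {P' : Option (Pending (blowup C))} (hcs : IsCanonicalStep R N ν s.L s.P C P') :
    (C.support : Set s.W) ⊆ (treatedPartIdeal N ν s j hcl).subschemeι.base ''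
      (Scheme.regularLocus (treatedPartIdeal N ν s j hcl).subscheme)ᶜ := by
  obtain ⟨C₀, P₀, hln, x', hcs₀, -, -, -, e, rfl⟩ := hf
  subst e
  change P₀ ≠ none at hs'
  obtain rfl : C = C₀ := hcs.centre_unique hRf hcs₀
  rw [hP] at hcs₀
  obtain ⟨j₀, hj₀, hcl₀, t, hRt, hrep⟩ := hcs₀
  have hjj : j = j₀ := hj.unique hj₀
  subst hjj
  obtain ⟨-, hover, -⟩ := hRa _ _ hRt
  cases t with
  | nil _ =>
    obtain ⟨-, hnone⟩ := hrep
    exact absurd hnone hs'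
  | cons D rest =>
    have hsupp := hrep.support_eq_closure
    obtain ⟨hD, -⟩ := hover
    rw [hsupp, ((Scheme.IdealSheafData.vanishingIdeal ⟨s.L.part (Scheme.hsStratum s.W N ν) j, hcl₀⟩).subschemeι
      |>.isClosedEmbedding.isClosedMap _ D.support.isClosed).closure_eq]
    exact Set.image_mono hD

end StepProjection

/-! ## §3. The blow-downs composed along a chain -/

/-- The composite of the step projections of a chain from stage `r + d` down to stage `r`. [folklore] -/
def chainComp (c : ℕ → MarkedStage.{u}) (f : ∀ n, (c (n + 1)).W ⟶ (c n).W) (r : ℕ) : ∀ d : ℕ, ((c (r + d)).W ⟶ (c r).W)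
  | 0 => 𝟙 _
  | d + 1 => f (r + d) ≫ chainComp c f r d

/-- Unfolding. [folklore] -/
@[simp] theorem chainComp_zero (c : ℕ → MarkedStage.{u}) (f : ∀ n, (c (n + 1)).W ⟶ (c n).W) (r : ℕ) :
    chainComp c f r 0 = 𝟙 _ := rfl

/-- Unfolding. [folklore] -/
theorem chainComp_succ (c : ℕ → MarkedStage.{u}) (f : ∀ n, (c (n + 1)).W ⟶ (c n).W) (r d : ℕ) :
    chainComp c f r (d + 1) = f (r + d) ≫ chainComp c f r d := rfl

/-- **The composed blow-downs map the chain point to the chain point.** [folklore] -/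
theorem chainComp_base_pt {c : ℕ → MarkedStage.{u}} {f : ∀ n, (c (n + 1)).W ⟶ (c n).W}
    (hf : ∀ n, StepProjection R N ν (c n) (c (n + 1)) (f n)) (r : ℕ) :
    ∀ d, (chainComp c f r d).base (c (r + d)).pt = (c r).pt
  | 0 => rfl
  | d + 1 => by
    rw [chainComp_succ, Scheme.Hom.comp_apply]
    have h1 : (f (r + d)) (c (r + (d + 1))).pt = (c (r + d)).pt := (hf (r + d)).base_pt
    rw [h1]
    exact chainComp_base_pt hf r d

/-! ## §4. Row (c-reg) and the PROVED reduction of the replay row (c-rep) -/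

/-- [OURS · L1 W4.2] **ROW (c-reg) — AT LATE CYCLE STARTS THE REDUCED TREATED PART IS REGULAR AT THE CHAIN POINT.** For every
functional admissible oracle, value `ν`, `Q`-maximal origin of characteristic `p` at level `N` and every MOVING, NEVER-ISOLATED
`G`-chain `x_n ∈ X_n(ν)` from it: from some stage on, whenever `X_r` is between cycles (`(c r).P = none`, the next cycle treats the least
label `j`), every point of the reduced treated part `S_r = (Y_r^{(j)})_red` lying over the chain point `x_r` is a REGULAR point of `S_r`
(so `x_r ∉ Y_r^{(j)}`, or `Y_r^{(j)}` is regular at `x_r`). Intended proof (`G = (ē ≤ 2)`): after the first cycles of the finitely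
many early labels, the part of a label through the chain point is ONE regular curve (the dominating near curve `Z ≅ D` over a
regular curve `D ∋ x` with `ē_x ≤ 2`: `e_{η_D} ≤ 1` by Thm. 3.6, Thm. 3.14 at `η_D`, `Z → D` finite birational onto regular ⇒ iso;
no other component of that label passes through the chain point — no re-entry). OURS row, OPEN; NOT a statement of the manuscript.
[cite: CossartJannsenSaito2020, Rem. 6.29 (1), Thm. 3.6, Thm. 3.14] -/
def StrataCycleStartRegular (p N : ℕ) (Q : ℕ → (ℕ → ℕ) → ∀ X : Scheme.{u}, X → Prop) (G : MarkedStage.{u} → Prop) : Prop :=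
  ∀ (R : ∀ S : Scheme.{u}, CentreSeq S → Prop), OracleFunctional R → OracleAdmissible R →
  ∀ (ν : ℕ → ℕ) (X : Scheme.{u}) [IsLocallyNoetherian X] (x : X), IsMaximalOrigin p N ν X x → Q N ν X x →
  ∀ c : ℕ → MarkedStage.{u}, Reaches R N ν (MarkedStage.init X x) (c 0) →
    (∀ n, CanonicalNearStep R N ν (c n) (c (n + 1))) → (∀ n, G (c n)) → (∀ n, ¬ Iso N (c n)) →
    (∀ n, ∃ m, n ≤ m ∧ (c m).IsBlownUp R N ν) →
    ∃ n₁, ∀ r, n₁ ≤ r → (c r).P = none →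
      ∀ (hcl : IsClosed ((c r).L.part (Scheme.hsStratum (c r).W N ν) (treatedLabel N ν (c r))))
        (y : ↥((treatedPartIdeal N ν (c r) (treatedLabel N ν (c r)) hcl).subscheme)),
        (treatedPartIdeal N ν (c r) (treatedLabel N ν (c r)) hcl).subschemeι.base y = (c r).pt →
          y ∈ Scheme.regularLocus (treatedPartIdeal N ν (c r) (treatedLabel N ν (c r)) hcl).subscheme

/-- **ROW (c-rep) FROM ROW (c-reg) — PROVED** (any origin predicate `Q`, any grade `G`): replayed centres lie over the non-regular
locus of the treated part at the cycle's start, the replay squares carry the chain point `x_n ↦ x_r` — so a late replay centre through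
the chain point would make `x_r` a non-regular point of `S_r`. [cite: CossartJannsenSaito2020, Rem. 6.29 (1), p. 102] -/
theorem strataReplayBlowupsSettle_of_cycleStartRegular {p N : ℕ} {Q : ℕ → (ℕ → ℕ) → ∀ X : Scheme.{u}, X → Prop}
    {G : MarkedStage.{u} → Prop} (hreg : StrataCycleStartRegular p N Q G) : StrataReplayBlowupsSettle p N Q G := by
  intro R hRf hRa ν X _ x hX hQ c h0 hstep hG hnI hmov
  obtain ⟨n₁, hn₁⟩ := hreg R hRf hRa ν X x hX hQ c h0 hstep hG hnI hmov
  -- cycle package along the chain (for closedness of the parts), step projections, non-empty strata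
  obtain ⟨-, k, _, hinv⟩ := exists_cycleInv_chain' hRf hRa hX h0 hstep
  have hproj : ∀ n, ∃ f : (c (n + 1)).W ⟶ (c n).W, StepProjection R N ν (c n) (c (n + 1)) f :=
    fun n => (hstep n).exists_stepProjection
  choose f hf using hproj
  have hne : ∀ n, (Scheme.hsStratum (c n).W N ν).Nonempty := fun n =>
    ⟨_, pt_mem_hsStratum_of_reaches hX.mem_stratum (reaches_chain h0 hstep n)⟩
  have hclP : ∀ n i, IsClosed ((c n).L.part (Scheme.hsStratum (c n).W N ν) i) := fun n i => by
    haveI := (hinv n).isNoetherian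
    exact (c n).L.isClosed_part (hinv n).isClosed_hsStratum (componentsIn.finite _) i
  -- the bad set at a cycle start `r`: the image of the non-regular locus of the reduced treated part
  let T : ∀ r, Set (c r).W := fun r =>
    (treatedPartIdeal N ν (c r) (treatedLabel N ν (c r)) (hclP r _)).subschemeι.base ''
      (Scheme.regularLocus (treatedPartIdeal N ν (c r) (treatedLabel N ν (c r)) (hclP r _)).subscheme)ᶜ
  have hT : ∀ r, n₁ ≤ r → (c r).P = none → (c r).pt ∉ T r := by
    rintro r hr hP ⟨y, hy, hyx⟩
    exact hy (hn₁ r hr hP (hclP r _) y hyx)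
  -- the replay invariant relative to a cycle start `r`, `d` steps later
  let Good : ℕ → ℕ → Prop := fun r d =>
    ∀ Q', (c (r + d)).P = some Q' → Q'.rest.CentresOver ((Q'.hom ≫ chainComp c f r d).base ⁻¹' T r)
  -- a late stage between cycles
  obtain ⟨m₀', hm₀'le, hm₀'⟩ := exists_next_none hstep n₁
  set m₀ := m₀' + 1 with hm₀def
  have hm₀n₁ : n₁ ≤ m₀ := by omega
  -- every stage `m ≥ m₀` lies in a cycle started at some `r ∈ [n₁, m]` along which the invariant holds
  have main : ∀ m, m₀ ≤ m → ∃ r d, r + d = m ∧ n₁ ≤ r ∧ (c r).P = none ∧ Good r d := by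
    intro m hm
    induction m, hm using Nat.le_induction with
    | base => exact ⟨m₀, 0, rfl, hm₀n₁, hm₀', fun Q' hQ' => (Option.some_ne_none Q' (hQ'.symm.trans hm₀')).elim⟩
    | succ m hm ih =>
      obtain ⟨r, d, hd, hr, hrP, hgood⟩ := ih
      subst hd
      rcases hP : (c (r + d + 1)).P with _ | Q'
      · -- a new cycle starts here
        exact ⟨r + d + 1, 0, rfl, by omega, hP, fun Q'' hQ'' => (Option.some_ne_none Q'' (hQ''.symm.trans hP)).elim⟩
      · rcases hPm : (c (r + d)).P with _ | Q
        · -- the step `r + d → r + d + 1` STARTS a cycle: fresh invariant relative to `r + d`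
          refine ⟨r + d, 1, rfl, by omega, hPm, fun Q'' hQ'' => ?_⟩
          have hQQ : Q'' = Q' := Option.some_injective _ (hQ''.symm.trans hP)
          subst hQQ
          have := (hf (r + d)).centresOver_of_none hRa hPm (isLeast_treatedLabel_of_none hPm (hne _)) (hclP _ _) hQ''
          simpa [chainComp_succ, chainComp_zero] using this
        · -- a replay step inside the cycle started at `r`
          refine ⟨r, d + 1, rfl, hr, hrP, fun Q'' hQ'' => ?_⟩
          have := (hf (r + d)).centresOver_of_some hPm (chainComp c f r d) (T r) (hgood Q hPm) hQ''
          simpa [chainComp_succ] using this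
  -- conclusion
  refine ⟨m₀, fun m hm hbu => ?_⟩
  by_contra hne'
  obtain ⟨r, d, hd, hr, hrP, hgood⟩ := main m hm
  subst hd
  obtain ⟨C, P', hcs, hpt⟩ := hbu
  rcases hPm : (c (r + d)).P with _ | Q
  · -- cycle start that is not a cycle end: the centre lies over the non-regular locus of the treated part at `r + d`
    have hsub := (hf (r + d)).support_subset_image_of_none hRf hRa hPm (isLeast_treatedLabel_of_none hPm (hne _)) (hclP _ _)
      hne' hcs
    exact hT (r + d) (by omega) hPm (hsub hpt)
  · -- replay step: the centre lies over `T r` through the replayed immersion and the blow-downs, which map `x_{r+d} ↦ x_r`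
    have hsub := (hf (r + d)).support_subset_image_of_some hRf hPm hne' (hgood Q hPm) hcs
    obtain ⟨y, hy, hyx⟩ := hsub hpt
    apply hT r hr hrP
    have h1 : (chainComp c f r d).base (Q.hom.base y) ∈ T r := by
      rw [Set.mem_preimage, Scheme.Hom.comp_apply] at hy
      exact hy
    have h2 : Q.hom.base y = (c (r + d)).pt := hyx
    rw [h2, chainComp_base_pt hf r d] at h1
    exact h1

/-- **THE STRATA-HALF FROM (b-end), (c-geo) AND (c-reg)** (any `Q`, `G`). [cite: CossartJannsenSaito2020, Rem. 6.29 (1), Thm. 6.35, Prop. 6.31] -/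
theorem maxOriginNoMovingNearChainAtQ_notIso_of_births_centreIO_cycleStartRegular {p N : ℕ}
    {Q : ℕ → (ℕ → ℕ) → ∀ X : Scheme.{u}, X → Prop} {G : MarkedStage.{u} → Prop}
    (hend : StrataCycleEndBirthsSettle p N (QNe Q) G) (hgeo : StrataLineageInCentreIO p N (QNe Q) G)
    (hreg : StrataCycleStartRegular p N (QNe Q) G) : MaxOriginNoMovingNearChainAtQ p N Q fun s => G s ∧ ¬ Iso N s :=
  maxOriginNoMovingNearChainAtQ_notIso_of_geometric_kernels hend hgeo (strataReplayBlowupsSettle_of_cycleStartRegular hreg)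

/-- **`Wlow3CharStrataM p` (G1′) FROM (b-end), (c-geo) AND (c-reg)** (by name; `N = 3`, `Q = QNe (QCharRegime p)`, `G = (ē ≤ 2)`).
[cite: CossartJannsenSaito2020, Thm. 6.35, Prop. 6.31, Rem. 6.29 (1)] -/
theorem wlow3CharStrataM_of_births_centreIO_cycleStartRegular {p : ℕ}
    (hend : StrataCycleEndBirthsSettle.{0} p 3 (QNe (Helpers.QCharRegime p)) fun s => s.geomDirDim ≤ 2)
    (hgeo : StrataLineageInCentreIO.{0} p 3 (QNe (Helpers.QCharRegime p)) fun s => s.geomDirDim ≤ 2)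
    (hreg : StrataCycleStartRegular.{0} p 3 (QNe (Helpers.QCharRegime p)) fun s => s.geomDirDim ≤ 2) :
    Wlow3CharStrataM p :=
  maxOriginNoMovingNearChainAtQ_notIso_of_births_centreIO_cycleStartRegular hend hgeo hreg

/-- **`WlowStrataM p` (G1′, regime-free) FROM (b-end), (c-geo) AND (c-reg)** (`Q = ⊤`). [cite: CossartJannsenSaito2020, Thm. 6.35, Prop. 6.31] -/
theorem wlowStrataM_of_births_centreIO_cycleStartRegular {p : ℕ}
    (hend : StrataCycleEndBirthsSettle.{0} p 3 (QNe fun _ _ _ _ => True) fun s => s.geomDirDim ≤ 2)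
    (hgeo : StrataLineageInCentreIO.{0} p 3 (QNe fun _ _ _ _ => True) fun s => s.geomDirDim ≤ 2)
    (hreg : StrataCycleStartRegular.{0} p 3 (QNe fun _ _ _ _ => True) fun s => s.geomDirDim ≤ 2) : WlowStrataM p :=
  maxOriginNoMovingNearChainAt_of_atQ_true
    (maxOriginNoMovingNearChainAtQ_notIso_of_births_centreIO_cycleStartRegular hend hgeo hreg)

end Summit.ResolutionOfSingularities.ResolutionOfSingularities.Theorems.SigmaMaxModificationsCorridor3.Moving

end
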